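import Literature.MathematicalPhysics.QuantumFieldTheory.Balaban1983to89.B7BlockGeometry
import Literature.MathematicalPhysics.QuantumFieldTheory.Balaban1983to89.B8CurlGradHolonomy

/-!
# `Balaban1983to89.B7Eq61Linearization` — the linearised gauge covariance of the block average (B7 p. 28) and the
linearised averaging conditions `Q′λ = 0` (B7 (61), (78)–(81); B8 (1.29); B9 (3.19), (3.21)): exact lattice identities

CITATION HEADER (lean-in-tree rule 2026-08-18).  The papers quoted are UNDER ADJUDICATION by the audit cell
`pub-balaban` (near-miss programme `Balaban 4-d lattice YM UV stability series`); nothing printed in them is asserted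
here as a fact.  Every quotation below was re-read for this module from the x2 page renders (PNG read as an image, not
an OCR layer): B7 = T. Bałaban, *Averaging operations for lattice gauge theories*, Comm. Math. Phys. **98**, 17–51 (1985)
[Balaban1985Averaging] (`paper:balaban1985-cmp98-averaging`, journal page = PDF page + 16), renders
`b2b-balaban-ref1/pages/1985-cmp98-averaging/1985-cmp98-averaging-pNNN-x2.png`, NNN = 011…014 (pp. 27–30), 019, 020
(pp. 35–36); B8 = T. Bałaban, *Spaces of regular gauge field configurations on a lattice and gauge fixing conditions*,
Comm. Math. Phys. **99**, 75–102 (1985) [Balaban1985RegularSpaces] (journal page = PDF page + 74), renders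
`…/1985-cmp99-regular-spaces-gauge-fixing/…-pNNN-x2.png`, NNN = 007, 008 (pp. 81–82); B9 = T. Bałaban, *Propagators for lattice
gauge theories in a background field*, Comm. Math. Phys. **99**, 389–434 (1985) [Balaban1985BackgroundPropagators]
(journal page = PDF page + 388), renders `…/1985-cmp99-background-propagators/…-pNNN-x2.png`, NNN = 005, 006 (pp. 393–394).
References inside the quotations: B7's [1] = Bałaban, CMP 85 (1982); B7's [2] = Bałaban, *Propagators and
renormalization transformations for lattice gauge theories. I*, CMP 95 (1984) [Balaban1984PropagatorsI] (its (1.11) is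
the tree's `B7BlockGeometry.Qav`); B8's [3] = B7; B9's [5] = B7.  Cell records: GAPS C-B8-39 (this certificate;
C-B8-37 item (a)), DIVERGENCE D-b08-g15.1; unit `b2b-balaban-b08-g15`.  No existing module is modified; this module
imports `…B7BlockGeometry` (for `Qav`, the block geometry `blockSites`, `sum_blockSites_add_single`, `sum_blockSites_mul`)
and `…B8CurlGradHolonomy` (for `covD`, `norm_conj_sub_le`, `norm_conj_le`) and touches nothing else.

WHAT IS PRINTED (verbatim; `‾` = the paper's overbar).
* B7 p. 27 [PDF 11]: *"Let us recall that if we apply a gauge transformation v to a configuration V, V^v_b =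
  v(b₋)V_b v⁻¹(b₊), b ⊂ Ω′, then (V̄^v)_c = v(c₋)V̄_c v⁻¹(c₊), c ⊂ Ω′⁽¹⁾."*  (55)–(56): *"V′^v_b = v(b₋)V′_b R(V_{0,b})v⁻¹(b₊)
  = v(b₋)V′_b R_{0,b}v⁻¹(b₊), (55) where for arbitrary invertible matrix X the operator R(X) is given by the formula
  R(X)Y = XYX⁻¹. (56)"*  (58): *"(R_{0,y}V′)(Γ_{y,x}) = Π_{b⊂Γ_{y,x}} R(V₀(Γ_{y,b₋}))V′_b = 1, x ∈ B(y), x ≠ y. (58)"*;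
  *"(R_{0,y}v)(x) = R(V₀(Γ_{y,x}))v(x),"*.  Bottom of p. 27: *"To find a form of this condition, let us recall the
  simplest case of one vector field considered in paper [1]. To change a gauge, we make a gauge transformation λ
  satisfying (Q′λ)(y) = Σ_{x∈B(y)} L⁻ᵈλ(x) = 0. Such a transformation does not change the average given by (1.11) in [2],
  and this is very important because the explicit representations of propagators, and other formulas, hold for this
  specific form of the averaging operation. In the considered general case, we will also try to find the additional
  condition on gauge transformation requiring that the form of the averaging operation should be preserved. We will be
  able to obtain only an approximate invariance."*
* B7 p. 28 [PDF 12] (the display typed here; it carries no equation number and sits between (60) and (61)):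
  *"Because of the axial gauge conditions (58), the average (V′V₀)‾_c depends on (R_{0,c₋}V′)([x, x(c)]) =
  Π_{b⊂[x,x(c)]} R(V₀(Γ_{c₋,x}∪[x, b₋]))V′_b, x ∈ B(c₋), and a good approximation of the function
  (1/i) log(V′V₀)‾_c(V̄₀)_c⁻¹ for V′ = e^{iA}, A small, is given by (Q₀A)(c) = Σ_{x∈B(c₋)} L⁻ᵈ(R_{0,c₋}A)([x, x(c)]), where
  R_{0,c₋}A is defined as R_{0,c₋}V′, only the product over b is replaced by the sum. If we make a small gauge
  transformation v = e^{iλ}, then a good approximation of this transformation acting on Lie algebra variables A is given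
  by A^λ_b = A_b − (R_{0,b}λ(b₊) − λ(b₋)) = A_b − (D_{V₀}λ)(b). Under such a transformation the average Q₀A changes as
  follows: (Q₀A^λ)(c) = Σ_{x∈B(c₋)} L⁻ᵈ(R_{0,c₋}λ)(x) + (Q₀A)(c) − Σ_{x′∈B(c₊)} L⁻ᵈ(R_{0,c₋}λ)(x′). If we define
  (Q′₀λ)(y) = Σ_{x∈B(y)} L⁻ᵈ(R_{0,y}λ)(x), then the first term in the right-hand side above is equal to (Q′₀λ)(c₋). There
  are troubles with the second term because Σ_{x′∈B(c₊)} L⁻ᵈ(R_{0,c₋}λ)(x′) = Σ_{x′∈B(c₊)} L⁻ᵈR(V₀(Γ_{c₋,x}∪[x, x′]))λ(x′)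
  = Σ_{x′∈B(c₊)} L⁻ᵈR(V₀(Γ_{c,x}∪(−c)))R(V₀(c))(R_{0,c₊}λ)(x′), and this expression is only approximately equal to
  R(V₀(c))(Q′₀λ)(c₊), because V₀(Γ_{c,x}∪(−c)) are close to 1 for V₀ regular, but not necessarily equal to 1. Now if we
  assume that λ satisfies the conditions Q′₀λ = 0, then the form of Q₀A is approximately preserved under such a gauge
  transformation. Finally, these conditions are approximations for λ small to the conditions
  (R̄₀v)(y) = v(y) exp[i Σ_{x∈B(y)} L⁻ᵈ (1/i) log v⁻¹(y)(R_{0,y}v)(x)] = 1. (61)"*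
* B7 p. 30 [PDF 14]: *"Generally a one-step averaging transformation defined by a field configuration V₀ is given by
  (R̄₀v)(y) = (R(V₀)v‾)(y) = {(R(V₀)v)(x)}‾_{x∈B(y)} = v(y) exp[i Σ_{x∈B(y)} L⁻ᵈ (1/i) log v⁻¹(y)R(V₀(Γ_{y,x}))v(x)], (78)
  where v is defined on a lattice Ω′, y ∈ Ω′⁽¹⁾. For a given configuration U₀ we define inductively
  (R̄₀u)(x₁) = (R(U₀)u‾)(x₁), x₁ ∈ Ω⁽¹⁾, (79) (R̄₀u^{j+1})(x_{j+1}) = (R(Ū₀ʲ)R̄₀uʲ‾)(x_{j+1}), x_{j+1} ∈ Ω⁽ʲ⁺¹⁾. (80)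
  The additional conditions are (R̄₀uᵏ)(y) = 1, y ∈ Ω⁽ᵏ⁾. (81)"*
* B7 p. 36 [PDF 20] (125): *"We will denote the main term by Q_{V₀}, or Q₀ (Q₀A)_c = (Q_{V₀}A)_c =
  Σ_{x∈B(c₋)} L⁻⁽ᵈ⁺¹⁾(R_{0,c₋}A)([x, x′]), (125)"*; above it: *"The first term on the right-hand side above is the main
  term in this linear form, and it resembles the definition of the averaging operation Q in [2]."*
* B8 p. 81 [PDF 7] (1.29): *"(R̄₀uʲ)(y) = 1 for y ∈ Λ_j, j = 0, 1, …, k. (1.29)"*; p. 82 [PDF 8] (1.36)–(1.38):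
  *"Q_j(U₀, ηA) = B on Λ_j, j = 0, 1, …, k, B is given by formula (1.31) with V′ = Ũ′ʲ, |B| < 2dLα₁ by the assumption
  (1.35), (1.37) R(U₀)D^{η*}_{U₀}A = 0. (1.38)"*
* B9 p. 393 [PDF 5] (3.14)–(3.15): *"(1/(Lʲη)) Q_j(U, ηA) = Q_j(U)A + (1/(Lʲη)) C_j(U, LʲηA), (3.14) where Q_j(U)A is a
  linear part of the function (3.13) … Q_j(U) = Q(Ūʲ⁻¹)·…·Q(Ū)Q(U), (3.15) where Q(V) is given by the explicit formula
  (124) in [5]."*; *"Let us recall that the configuration U′ = e^{iηA} transforms by the formula (55) in [5] under a gauge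
  transformation u, i.e., U′^u(x, x′) = u(x)U′(x, x′)R(U(x, x′))u⁻¹(x′), and if u = e^{iλ}, then the part of this
  transformation linear in A and λ is given by A^λ = A − Dλ."*; (3.19): *"(Q′(V)λ)(y) = Σ_{x∈B(y)} L⁻ᵈR(V(Γ_{y,x}))λ(x),
  (Q′_j(U)λ)(y) = (Q′(Ūʲ⁻¹)·…·Q′(Ū)Q′(U)λ)(y) = Σ_{x∈Bʲ(y)} L⁻ʲᵈR(U(Γ⁽ʲ⁾_{y,x}))λ(x), y ∈ T⁽ʲ⁾_{Lʲη}. (3.19)"*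
* B9 p. 394 [PDF 6]: *"operators Q′_j(U) are linear parts of the averaging operations Ruʲ‾ for gauge transformations
  u = e^{iλ}, operations defined by (78)–(80) in [5]."*; (3.21): *"R = Δ^η_U N(Q′), N(Q′) = {λ : Q′λ = 0}. (3.21)"*.

THE TYPED OBJECTS (lattice `ℤᵈ` in scaled integer coordinates as in `QuantumLattice.BalabanRG` / `B7BlockGeometry`:
sites `Fin d → ℤ`, positively oriented bonds `(x, μ) = ⟨x, x + e_μ⟩ : ZdEdge d`, blocks `blockSites L y` = B7 (2) corner
cubes, the coarse lattice again `ℤᵈ`, the coarse bond `c = (y, μ) = ⟨y, y + e_μ⟩` with `c₋ = y`, `c₊ = y + e_μ`, and for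
`x ∈ B(c₋)` the translate `x(c) = x′ = x + L e_μ ∈ B(c₊)`).  Transporters take values in a monoid / group `G` acting on
the fibre `V` (an additive group with an `ℝ`-module structure for the weights `L⁻ᵈ`) by `•` — for B7's (56) take
`G = ConjAct Aˣ` acting on a matrix algebra `A` by `X Y X⁻¹` (`B8CurlGradHolonomy.adT`).  INPUT DATA, all free:
`R : ZdEdge d → G` (printed `R_{0,b} = R(V_{0,b})`, transport from `b₊` to `b₋`), `T : (Fin d → ℤ) → G` (printed
`R(V₀(Γ_{y,x}))`, the transporter from `x ∈ B(y)` to the corner `y` of ITS block — one global field, since `Γ_{y,x}` is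
determined by `x`; the identities below hold for EVERY `T`, so the shape of the contours `Γ_{y,x}` (B7 (52)–(53)) is not
needed and not modelled), `Rc : ZdEdge d → G` (printed `R(V₀(c))`, the transporter along the coarse bond), `lam` (`λ`),
`A`.  Then, literally as printed on p. 28: `lineR R x μ l = R(V₀([x, x + l e_μ]))` (ordered product, `pathProd`);
`covDZ R lam b = R_{0,b}λ(b₊) − λ(b₋) = (D_{V₀}λ)(b)` (= `B8CurlGradHolonomy.covD` along `e_μ`, `covDZ_eq_covD`);
`lineRA L T R A x μ = (R_{0,c₋}A)([x, x(c)]) = Σ_{l<L} R(V₀(Γ_{c₋,x}∪[x, x + l e_μ])) A_{(x + l e_μ, μ)}`;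
`Q0 L T R A c = (Q₀A)(c) = Σ_{x∈B(c₋)} L⁻ᵈ (R_{0,c₋}A)([x, x(c)])`; `Qp0 L T lam y = (Q′₀λ)(y) = Σ_{x∈B(y)} L⁻ᵈ (R_{0,y}λ)(x)`;
`farTerm L T R lam c = Σ_{x′∈B(c₊)} L⁻ᵈ R(V₀(Γ_{c₋,x}∪[x, x′]))λ(x′)` (indexed by `x = x′ − L e_μ ∈ B(c₋)`;
`farTerm_eq_sum_blockSites_succ` is the printed indexing by `x′ ∈ B(c₊)`); `loopHol L T R Rc c x =
R(V₀(Γ_{c,x} ∪ (−c))) = T(x)·R(V₀([x,x′]))·T(x′)⁻¹·R(V₀(c))⁻¹` (transport around the closed contour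
`c₋ → x → x′ → c₊ → c₋`); `defect` = the difference between the second term and `R(V₀(c))(Q′₀λ)(c₊)`.

WHAT IS PROVED (0 sorry; [folklore] = finite algebra the paper states without proof).
§1 `sum_transport_covD` — the telescoping identity along a contour: `Σ_{l<n} (h·g₀⋯g_{l−1}) • (g_l • φ_{l+1} − φ_l)
   = (h·g₀⋯g_{n−1}) • φ_n − h • φ_0` (any monoid action).
§2 (any monoid `G`) `lineRA_covDZ` : `(R_{0,c₋}D_{V₀}λ)([x, x(c)]) = R(V₀(Γ_{c₋,x}∪[x,x(c)]))λ(x(c)) − R(V₀(Γ_{c₋,x}))λ(x)`;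
   `Q0_covDZ` : `Q₀(D_{V₀}λ)(c) = farTerm(c) − (Q′₀λ)(c₋)`; **`Q0_gauge`** = THE p. 28 DISPLAY, exactly:
   `(Q₀A^λ)(c) = (Q′₀λ)(c₋) + (Q₀A)(c) − Σ_{x′∈B(c₊)} L⁻ᵈ(R_{0,c₋}λ)(x′)` with `A^λ = A − D_{V₀}λ`.
§3 (any group `G`) `transport_factor` / `farTerm_eq_loop` = the second p. 28 display
   `Σ_{x′} L⁻ᵈ R(V₀(Γ_{c₋,x}∪[x,x′]))λ(x′) = Σ_{x′} L⁻ᵈ R(V₀(Γ_{c,x}∪(−c))) R(V₀(c)) (R_{0,c₊}λ)(x′)`;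
   `farTerm_eq_smul_Qp0_add_defect` : second term `= R(V₀(c)) • (Q′₀λ)(c₊) + defect(c)`;
   **`Q0_covDZ_eq_covDZ_Qp0_add_defect`** : `Q₀(D_{V₀}λ)(c) = (D_{V̄₀}Q′₀λ)(c) + defect(c)` with the COARSE covariant
   derivative `(D_{V̄₀}Φ)(c) = R(V₀(c))Φ(c₊) − Φ(c₋)` (`covDZ Rc`) — block averaging intertwines the fine and the coarse
   covariant derivatives up to the loop-holonomy defect; `defect_eq_zero_of_loopHol_eq_one` : the defect vanishes when
   every `V₀(Γ_{c,x}∪(−c)) = 1` ("not necessarily equal to 1" is the only obstruction); **`Q0_gauge_of_Qp0_eq_zero`** :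
   if `Q′₀λ = 0` then `(Q₀A^λ)(c) = (Q₀A)(c) − defect(c)` ("the form of Q₀A is approximately preserved", made exact).
§4 (`G = ConjAct Aˣ`, `A` a normed `ℝ`-algebra, transporters of operator norm `≤ 1` with inverses of norm `≤ 1`, e.g.
   unitary matrices) **`norm_defect_le`** : if `‖V₀(Γ_{c,x}∪(−c)) − 1‖ ≤ ε` on `B(c₋)` and `‖λ‖ ≤ Λ` on `B(c₊)` then
   `‖defect(c)‖ ≤ 2εΛ`, hence `norm_Q0_gauge_sub_le` : `‖(Q₀A^λ)(c) − (Q₀A)(c)‖ ≤ 2εΛ` for `λ ∈ N(Q′₀)` — the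
   quantitative form of "approximately preserved" ("close to 1 for V₀ regular": `ε` small).
§5 FLAT CASE `V₀ = 1` over `ℝ`, BY NAME on the tree's `B7BlockGeometry.Qav M` (= [2] (1.11) = (125) at ratio `M`,
   weight `M⁻⁽ᵈ⁺¹⁾`): `dZ lam b = λ(b₊) − λ(b₋)`; `Qp M` = the flat `Q′` at ratio `M` (block mean, weight `M⁻ᵈ`; p. 27
   bottom, (3.19) with `R ≡ 1`), `Qp_Qp` : `Q′_K ∘ Q′_M = Q′_{MK}` (the composition rule (3.19));
   **`Qav_dZ`** : `(Q_M ∂λ)(y, μ) = M⁻¹((Q′_Mλ)(y + e_μ) − (Q′_Mλ)(y))`; `Qav_dZ_eq_zero_iff` : `Q_M ∂λ = 0` iff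
   `Q′_Mλ` is constant along every coarse bond; **`Qav_gauge_of_Qp_eq_zero`** = p. 27 *"Such a transformation does not
   change the average given by (1.11) in [2]"*: `Q′_Mλ = 0 ⇒ Q_M(A − ∂λ) = Q_M A`, and `Qav_pow_gauge_of_null` : the same
   simultaneously for all ratios `Lʲ`, `j ≤ k` (the flat, all-of-`ℤᵈ` reading of `λ ∈ N(Q′)`, (3.21), and of the family of
   constraints (1.36) `Q_j(U₀, ηA) = B, j = 0, …, k`: a pure-gauge increment `−∂λ`, `λ ∈ N(Q′)`, is invisible to every
   one of them — these are the directions handled by the gauge-fixing density B9 (3.17) `∫dλ δ(Q′λ)…` and (1.38), not by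
   the averaging constraints); dictionary lemmas `covDZ_const_one`, `Qp0_const_one`,
   `Q0_const_one` (`Q0` with trivial transporters `= L • Qav L`: the p. 28 weight `L⁻ᵈ` against the (125)/(1.11) weight
   `L⁻⁽ᵈ⁺¹⁾`, i.e. (3.14)'s `Lʲη Q_j(U)` at `j = 1`, `η = 1`), `defect_const_one` (flat ⇒ defect `= 0`).

DIVERGENCE (recorded as D-b08-g15.1, not silent).  (i) Carrier: all of `ℤᵈ` (free boundary, scaled integer
coordinates) instead of the finite `Ω ⊂ ηℤᵈ` / tori of B7–B9; every identity is a finite sum per coarse bond, so it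
restricts verbatim to unions of blocks.  (ii) The contours `Γ_{y,x}` are not modelled: `T` is an arbitrary site
transporter field (the printed one is one instance), which only makes the identities more general; consequently
`R(V₀(c))` is a free input `Rc` (printed: the transporter of the straight coarse bond; with `T(c₋) = 1` the choice
`Rc c = R(V₀([c₋, c₊]))` is the one for which `loopHol … c c₋ = 1`).  (iii) One averaging step (`j = 1`) with general
`V₀`; the multi-level statements (`j ≤ k`) are typed in the flat case only, where (3.15)/(3.19) compose by
`B7BlockGeometry.Qav_Qav` / `Qp_Qp`.  (iv) §4's norm hypotheses (`‖·‖ ≤ 1` for the transporters and their inverses) are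
the operator-norm reading of unitarity, as in `B8CurlGradHolonomy` (D-b08-g14.3).  (v) Only the LINEARISATIONS printed
on p. 28 / (3.14) / p. 394 are typed — the non-linear averages (61), (78)–(81), (1.29) themselves are quoted, not
defined here (the tree's `QuantumLattice.BalabanBlockAverage.balabanGroupMean` is the exp-mean-log average of (42)/(78)).
VALUE = kernel certificate of two printed-but-unproved displays (B7 p. 28) and of the p. 27 invariance claim, with the
"approximately" made quantitative; closes the flat / linearised part of GAPS C-B8-37 item (a); NOT summit progress.
-/

noncomputable section

namespace Literature.MathematicalPhysics.QuantumFieldTheory.Balaban1983to89.B7Eq61Linearization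

open Finset
open Literature.MathematicalPhysics.QuantumLattice (ZdEdge blockMap blockSites mem_blockSites_iff card_blockSites)
open Literature.MathematicalPhysics.QuantumFieldTheory.Balaban1983to89.B7BlockGeometry (Qav Qav_apply
  sum_blockSites_add_single sum_blockSites_mul Qav_Qav)
open Literature.MathematicalPhysics.QuantumFieldTheory.Balaban1983to89.B8CurlGradHolonomy (covD covD_apply
  norm_conj_sub_le norm_conj_le norm_units_mul_le_one norm_units_inv_mul_le_one)

variable {d : ℕ}

/-! ## 1. Transport along a contour: ordered products and the telescoping identity -/

section Telescoping

variable {G V : Type*} [Monoid G] [AddCommGroup V] [DistribMulAction G V]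

/-- [folklore] The ordered product `g 0 * g 1 * ⋯ * g (l-1)` (parallel transport along the first `l` bonds of a
contour; B7 p. 28 `V₀(Γ_{c₋,x} ∪ [x, b₋])`, the contours `Γ_{y,x}` being those of B7 (52)–(53) — B9 p. 393: "defined by
(52), (53) in [5]"). -/
def pathProd (g : ℕ → G) (l : ℕ) : G := ((List.range l).map g).prod

/-- [folklore] the empty contour transports by `1`. -/
@[simp] theorem pathProd_zero (g : ℕ → G) : pathProd g 0 = 1 := by simp [pathProd]

/-- [folklore] appending one bond multiplies on the right. -/
theorem pathProd_succ (g : ℕ → G) (l : ℕ) : pathProd g (l + 1) = pathProd g l * g l := by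
  simp [pathProd, List.range_succ, List.map_append, List.prod_append]

/-- [folklore] trivial transporters transport by `1`. -/
@[simp] theorem pathProd_const_one (l : ℕ) : pathProd (fun _ => (1 : G)) l = 1 := by
  induction l with
  | zero => simp
  | succ l ih => rw [pathProd_succ, ih, mul_one]

/-- [folklore] **Telescoping along a contour.**  For bond transporters `g_l` (from the `(l+1)`-st point back to the
`l`-th), an initial transporter `h` and fibre values `φ_l` at the points of the contour:
`Σ_{l<n} (h g₀⋯g_{l−1}) • (g_l • φ_{l+1} − φ_l) = (h g₀⋯g_{n−1}) • φ_n − h • φ_0` — the transported sum of the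
covariant differences is the covariant difference of the endpoints (B7 p. 28: `(R_{0,c₋}A)([x,x(c)])` applied to
`A = D_{V₀}λ`). -/
theorem sum_transport_covD (h : G) (g : ℕ → G) (φ : ℕ → V) (n : ℕ) :
    ∑ l ∈ range n, (h * pathProd g l) • (g l • φ (l + 1) - φ l)
      = (h * pathProd g n) • φ n - h • φ 0 := by
  induction n with
  | zero => simp
  | succ n ih =>
    rw [sum_range_succ, ih, pathProd_succ, smul_sub, ← mul_smul, ← mul_assoc]
    abel

end Telescoping

/-! ## 2. B7 p. 28 on `ℤᵈ` with a general background: `Q₀`, `Q′₀`, `D_{V₀}` and the first display -/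

section Background

variable {G V : Type*} [Monoid G] [AddCommGroup V] [DistribMulAction G V]

/-- [cite: Balaban1985Averaging, p.28] `R(V₀([x, x + l e_μ])) = R_{0,(x,μ)} R_{0,(x+e_μ,μ)} ⋯ R_{0,(x+(l−1)e_μ,μ)}`:
the transporter of the straight contour of `l` bonds in direction `μ` from `x`. -/
def lineR (R : ZdEdge d → G) (x : Fin d → ℤ) (μ : Fin d) (l : ℕ) : G :=
  pathProd (fun t => R (x + Pi.single μ (t : ℤ), μ)) l

/-- [cite: Balaban1985Averaging, p.28] `(D_{V₀}λ)(b) = R_{0,b}λ(b₊) − λ(b₋)` for `b = (x, μ) = ⟨x, x + e_μ⟩`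
(B9 p. 393: `A^λ = A − Dλ`). -/
def covDZ (R : ZdEdge d → G) (lam : (Fin d → ℤ) → V) : ZdEdge d → V :=
  fun b => R b • lam (b.1 + Pi.single b.2 1) - lam b.1

/-- [folklore] unfolding of `covDZ`. -/
@[simp] theorem covDZ_apply (R : ZdEdge d → G) (lam : (Fin d → ℤ) → V) (b : ZdEdge d) :
    covDZ R lam b = R b • lam (b.1 + Pi.single b.2 1) - lam b.1 := rfl

/-- [folklore] `covDZ` is the lineage's `B8CurlGradHolonomy.covD` along the shift `x ↦ x + e_μ` (B9 (3.2′)/(3.3) at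
`η = 1`), so the two modules speak about the same operator. -/
theorem covDZ_eq_covD (R : ZdEdge d → G) (lam : (Fin d → ℤ) → V) (x : Fin d → ℤ) (μ : Fin d) :
    covDZ R lam (x, μ) = covD (fun z : Fin d → ℤ => z + Pi.single μ 1) (fun z => R (z, μ)) lam x := rfl

/-- [folklore] `D_{V₀}` is additive in `λ`. -/
theorem covDZ_add (R : ZdEdge d → G) (lam lam' : (Fin d → ℤ) → V) :
    covDZ R (lam + lam') = covDZ R lam + covDZ R lam' := by
  funext b
  simp only [covDZ_apply, Pi.add_apply, smul_add]
  abel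

/-- [folklore] `D_{V₀} 0 = 0`. -/
@[simp] theorem covDZ_zero (R : ZdEdge d → G) : covDZ R (0 : (Fin d → ℤ) → V) = 0 := by
  funext b
  simp

/-- [cite: Balaban1985Averaging, p.28] `(R_{0,c₋}A)([x, x(c)]) = Σ_{b⊂[x,x(c)]} R(V₀(Γ_{c₋,x} ∪ [x, b₋])) A_b`
("R_{0,c₋}A is defined as R_{0,c₋}V′, only the product over b is replaced by the sum"), the site transporter
`T x = R(V₀(Γ_{c₋,x}))` followed by the straight-line transporter to `b₋ = x + l e_μ`. -/
def lineRA (L : ℕ) (T : (Fin d → ℤ) → G) (R : ZdEdge d → G) (A : ZdEdge d → V) (x : Fin d → ℤ) (μ : Fin d) : V :=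
  ∑ l ∈ range L, (T x * lineR R x μ l) • A (x + Pi.single μ (l : ℤ), μ)

/-- [folklore] `R_{0,c₋}` (sum form) is additive in `A`. -/
theorem lineRA_sub (L : ℕ) (T : (Fin d → ℤ) → G) (R : ZdEdge d → G) (A B : ZdEdge d → V) (x : Fin d → ℤ)
    (μ : Fin d) : lineRA L T R (A - B) x μ = lineRA L T R A x μ - lineRA L T R B x μ := by
  simp only [lineRA, Pi.sub_apply, smul_sub, sum_sub_distrib]

/-- [folklore] **`(R_{0,c₋}D_{V₀}λ)([x, x(c)]) = R(V₀(Γ_{c₋,x}∪[x, x(c)]))λ(x(c)) − R(V₀(Γ_{c₋,x}))λ(x)`** — the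
telescoping of § 1 along the straight contour `[x, x + L e_μ]` (the step behind the first p. 28 display). -/
theorem lineRA_covDZ (L : ℕ) (T : (Fin d → ℤ) → G) (R : ZdEdge d → G) (lam : (Fin d → ℤ) → V) (x : Fin d → ℤ)
    (μ : Fin d) :
    lineRA L T R (covDZ R lam) x μ
      = (T x * lineR R x μ L) • lam (x + Pi.single μ (L : ℤ)) - T x • lam x := by
  have key := sum_transport_covD (T x) (fun t : ℕ => R (x + Pi.single μ (t : ℤ), μ))
    (fun t : ℕ => lam (x + Pi.single μ (t : ℤ))) L
  beta_reduce at key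
  rw [Nat.cast_zero, Pi.single_zero, add_zero] at key
  unfold lineRA lineR
  rw [← key]
  refine sum_congr rfl fun l _ => ?_
  simp only [covDZ_apply, add_assoc, ← Pi.single_add, Nat.cast_succ]

variable [Module ℝ V]

/-- [cite: Balaban1985Averaging, p.28] `(Q₀A)(c) = Σ_{x∈B(c₋)} L⁻ᵈ (R_{0,c₋}A)([x, x(c)])` (the p. 28 weight `L⁻ᵈ`;
(125) has `L⁻⁽ᵈ⁺¹⁾`, cf. `Q0_const_one`). -/
def Q0 (L : ℕ) (T : (Fin d → ℤ) → G) (R : ZdEdge d → G) (A : ZdEdge d → V) : ZdEdge d → V :=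
  fun c => ∑ x ∈ blockSites L c.1, ((L : ℝ) ^ d)⁻¹ • lineRA L T R A x c.2

/-- [cite: Balaban1985Averaging, p.28] `(Q′₀λ)(y) = Σ_{x∈B(y)} L⁻ᵈ (R_{0,y}λ)(x)`, `(R_{0,y}λ)(x) = R(V₀(Γ_{y,x}))λ(x)`
(p. 27) — B9 (3.19) `(Q′(V)λ)(y) = Σ_{x∈B(y)} L⁻ᵈR(V(Γ_{y,x}))λ(x)`, the linear part of (78) (B9 p. 394). -/
def Qp0 (L : ℕ) (T : (Fin d → ℤ) → G) (lam : (Fin d → ℤ) → V) : (Fin d → ℤ) → V :=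
  fun y => ∑ x ∈ blockSites L y, ((L : ℝ) ^ d)⁻¹ • T x • lam x

/-- [cite: Balaban1985Averaging, p.28] the "second term" `Σ_{x′∈B(c₊)} L⁻ᵈ (R_{0,c₋}λ)(x′) =
Σ_{x′∈B(c₊)} L⁻ᵈ R(V₀(Γ_{c₋,x}∪[x, x′]))λ(x′)`, written as a sum over `x = x′ − L e_μ ∈ B(c₋)`
(`farTerm_eq_sum_blockSites_succ` for the printed indexing). -/
def farTerm (L : ℕ) (T : (Fin d → ℤ) → G) (R : ZdEdge d → G) (lam : (Fin d → ℤ) → V) : ZdEdge d → V :=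
  fun c => ∑ x ∈ blockSites L c.1,
    ((L : ℝ) ^ d)⁻¹ • (T x * lineR R x c.2 L) • lam (x + Pi.single c.2 (L : ℤ))

/-- [folklore] unfolding of `Q0`. -/
theorem Q0_apply (L : ℕ) (T : (Fin d → ℤ) → G) (R : ZdEdge d → G) (A : ZdEdge d → V) (c : ZdEdge d) :
    Q0 L T R A c = ∑ x ∈ blockSites L c.1, ((L : ℝ) ^ d)⁻¹ • lineRA L T R A x c.2 := rfl

/-- [folklore] unfolding of `Qp0`. -/
theorem Qp0_apply (L : ℕ) (T : (Fin d → ℤ) → G) (lam : (Fin d → ℤ) → V) (y : Fin d → ℤ) :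
    Qp0 L T lam y = ∑ x ∈ blockSites L y, ((L : ℝ) ^ d)⁻¹ • T x • lam x := rfl

/-- [folklore] `Q′₀ 0 = 0`. -/
@[simp] theorem Qp0_zero (L : ℕ) (T : (Fin d → ℤ) → G) : Qp0 L T (0 : (Fin d → ℤ) → V) = 0 := by
  funext y
  simp [Qp0_apply]

/-- [folklore] `Q₀` is additive in `A` (it is linear; only the difference is needed below). -/
theorem Q0_sub (L : ℕ) (T : (Fin d → ℤ) → G) (R : ZdEdge d → G) (A B : ZdEdge d → V) (c : ZdEdge d) :
    Q0 L T R (A - B) c = Q0 L T R A c - Q0 L T R B c := by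
  simp only [Q0_apply, lineRA_sub, smul_sub, sum_sub_distrib]

/-- [folklore] **`Q₀(D_{V₀}λ)(c) = Σ_{x′∈B(c₊)} L⁻ᵈ(R_{0,c₋}λ)(x′) − (Q′₀λ)(c₋)`** (sum of `lineRA_covDZ` over the block,
weight `L⁻ᵈ`). -/
theorem Q0_covDZ (L : ℕ) (T : (Fin d → ℤ) → G) (R : ZdEdge d → G) (lam : (Fin d → ℤ) → V) (c : ZdEdge d) :
    Q0 L T R (covDZ R lam) c = farTerm L T R lam c - Qp0 L T lam c.1 := by
  simp only [Q0_apply, farTerm, Qp0_apply, lineRA_covDZ, smul_sub, sum_sub_distrib]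

/-- [cite: Balaban1985Averaging, p.28] **THE FIRST p. 28 DISPLAY, exactly:** with `A^λ = A − D_{V₀}λ`,
`(Q₀A^λ)(c) = (Q′₀λ)(c₋) + (Q₀A)(c) − Σ_{x′∈B(c₊)} L⁻ᵈ(R_{0,c₋}λ)(x′)`.  Holds for every monoid-valued transporter
data `T`, `R` and every fibre action — no smallness, no regularity. -/
theorem Q0_gauge (L : ℕ) (T : (Fin d → ℤ) → G) (R : ZdEdge d → G) (A : ZdEdge d → V)
    (lam : (Fin d → ℤ) → V) (c : ZdEdge d) :
    Q0 L T R (A - covDZ R lam) c = Qp0 L T lam c.1 + Q0 L T R A c - farTerm L T R lam c := by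
  rw [Q0_sub, Q0_covDZ]
  abel

/-- [folklore] the printed indexing of the second term: a sum over `x′ ∈ B(c₊) = B(c₋) + L e_μ`, with
`x = x′ − L e_μ` (`B7BlockGeometry.sum_blockSites_add_single`). -/
theorem farTerm_eq_sum_blockSites_succ (L : ℕ) (hL : 0 < L) (T : (Fin d → ℤ) → G) (R : ZdEdge d → G)
    (lam : (Fin d → ℤ) → V) (y : Fin d → ℤ) (μ : Fin d) :
    farTerm L T R lam (y, μ) = ∑ x' ∈ blockSites L (y + Pi.single μ 1),
      ((L : ℝ) ^ d)⁻¹ •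
        (T (x' - Pi.single μ (L : ℤ)) * lineR R (x' - Pi.single μ (L : ℤ)) μ L) • lam x' := by
  rw [farTerm, sum_blockSites_add_single L hL y μ 1]
  simp only [mul_one, add_sub_cancel_right]

end Background

/-! ## 3. The second p. 28 display: the loop holonomy `V₀(Γ_{c,x} ∪ (−c))` and the defect -/

section Loop

variable {G V : Type*} [Group G] [AddCommGroup V] [DistribMulAction G V] [Module ℝ V]

/-- [cite: Balaban1985Averaging, p.28] `R(V₀(Γ_{c,x} ∪ (−c)))`: the transporter around the closed contour
`c₋ → x → x′ = x + L e_μ → c₊ → c₋` (our reading of the printed factorisation `R(V₀(Γ_{c₋,x}∪[x, x′])) =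
R(V₀(Γ_{c,x}∪(−c))) R(V₀(c)) R(V₀(Γ_{c₊,x′}))`, the last factor being the one inside `(R_{0,c₊}λ)(x′)`):
`T(x) · R(V₀([x, x′])) · T(x′)⁻¹ · R(V₀(c))⁻¹` — DEFINED here by this formula (`transport_factor` is then an identity of
the group, whatever the contours are). -/
def loopHol (L : ℕ) (T : (Fin d → ℤ) → G) (R Rc : ZdEdge d → G) (c : ZdEdge d) (x : Fin d → ℤ) : G :=
  T x * lineR R x c.2 L * (T (x + Pi.single c.2 (L : ℤ)))⁻¹ * (Rc c)⁻¹

/-- [folklore] `R(V₀(Γ_{c₋,x}∪[x, x′])) = R(V₀(Γ_{c,x}∪(−c))) · R(V₀(c)) · R(V₀(Γ_{c₊,x′}))` (group algebra). -/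
theorem transport_factor (L : ℕ) (T : (Fin d → ℤ) → G) (R Rc : ZdEdge d → G) (c : ZdEdge d) (x : Fin d → ℤ) :
    T x * lineR R x c.2 L = loopHol L T R Rc c x * (Rc c * T (x + Pi.single c.2 (L : ℤ))) := by
  simp [loopHol, mul_assoc]

/-- [cite: Balaban1985Averaging, p.28] **THE SECOND p. 28 DISPLAY, exactly:**
`Σ_{x′∈B(c₊)} L⁻ᵈ R(V₀(Γ_{c₋,x}∪[x, x′]))λ(x′) = Σ_{x′∈B(c₊)} L⁻ᵈ R(V₀(Γ_{c,x}∪(−c))) R(V₀(c)) (R_{0,c₊}λ)(x′)`. -/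
theorem farTerm_eq_loop (L : ℕ) (T : (Fin d → ℤ) → G) (R Rc : ZdEdge d → G) (lam : (Fin d → ℤ) → V)
    (c : ZdEdge d) :
    farTerm L T R lam c = ∑ x ∈ blockSites L c.1, ((L : ℝ) ^ d)⁻¹ •
      loopHol L T R Rc c x • (Rc c * T (x + Pi.single c.2 (L : ℤ))) • lam (x + Pi.single c.2 (L : ℤ)) := by
  simp only [farTerm, transport_factor L T R Rc, mul_smul]

/-- [cite: Balaban1985Averaging, p.28] The DEFECT of the second term: `Σ_{x∈B(c₋)} L⁻ᵈ [R(V₀(Γ_{c,x}∪(−c))) − 1]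
R(V₀(c)) (R_{0,c₊}λ)(x′)` — "this expression is only approximately equal to R(V₀(c))(Q′₀λ)(c₊), because
V₀(Γ_{c,x}∪(−c)) are close to 1 for V₀ regular, but not necessarily equal to 1". -/
def defect (L : ℕ) (T : (Fin d → ℤ) → G) (R Rc : ZdEdge d → G) (lam : (Fin d → ℤ) → V) : ZdEdge d → V :=
  fun c => ∑ x ∈ blockSites L c.1, ((L : ℝ) ^ d)⁻¹ •
    (loopHol L T R Rc c x • (Rc c * T (x + Pi.single c.2 (L : ℤ))) • lam (x + Pi.single c.2 (L : ℤ))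
      - (Rc c * T (x + Pi.single c.2 (L : ℤ))) • lam (x + Pi.single c.2 (L : ℤ)))

/-- [folklore] **no defect on flat loops:** if every `V₀(Γ_{c,x}∪(−c)) = 1`, `x ∈ B(c₋)`, the defect vanishes. -/
theorem defect_eq_zero_of_loopHol_eq_one (L : ℕ) (T : (Fin d → ℤ) → G) (R Rc : ZdEdge d → G)
    (lam : (Fin d → ℤ) → V) (c : ZdEdge d) (h : ∀ x ∈ blockSites L c.1, loopHol L T R Rc c x = 1) :
    defect L T R Rc lam c = 0 := by
  unfold defect
  exact sum_eq_zero fun x hx => by rw [h x hx, one_smul, sub_self, smul_zero]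

variable [SMulCommClass G ℝ V]

/-- [folklore] **second term `= R(V₀(c)) • (Q′₀λ)(c₊) + defect`** (reindexing `x′ = x + L e_μ` over `B(c₊)`). -/
theorem farTerm_eq_smul_Qp0_add_defect (L : ℕ) (hL : 0 < L) (T : (Fin d → ℤ) → G) (R Rc : ZdEdge d → G)
    (lam : (Fin d → ℤ) → V) (y : Fin d → ℤ) (μ : Fin d) :
    farTerm L T R lam (y, μ)
      = Rc (y, μ) • Qp0 L T lam (y + Pi.single μ 1) + defect L T R Rc lam (y, μ) := by
  rw [farTerm_eq_loop L T R Rc, Qp0_apply, sum_blockSites_add_single L hL y μ 1, Finset.smul_sum, defect,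
    ← sum_add_distrib]
  refine sum_congr rfl fun x _ => ?_
  simp only [mul_one, smul_sub, mul_smul]
  rw [smul_comm (Rc (y, μ)) (((L : ℝ) ^ d)⁻¹) _]
  abel

/-- [folklore] **BLOCK AVERAGING INTERTWINES THE COVARIANT DERIVATIVES, up to the loop defect:**
`Q₀(D_{V₀}λ)(c) = R(V₀(c)) • (Q′₀λ)(c₊) − (Q′₀λ)(c₋) + defect(c) = (D_{V̄₀}(Q′₀λ))(c) + defect(c)`, the coarse
covariant derivative being `covDZ Rc` on the coarse lattice `ℤᵈ` (the two p. 28 displays combined). -/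
theorem Q0_covDZ_eq_covDZ_Qp0_add_defect (L : ℕ) (hL : 0 < L) (T : (Fin d → ℤ) → G) (R Rc : ZdEdge d → G)
    (lam : (Fin d → ℤ) → V) (y : Fin d → ℤ) (μ : Fin d) :
    Q0 L T R (covDZ R lam) (y, μ)
      = covDZ Rc (Qp0 L T lam) (y, μ) + defect L T R Rc lam (y, μ) := by
  rw [Q0_covDZ, farTerm_eq_smul_Qp0_add_defect L hL T R Rc, covDZ_apply]
  abel

/-- [folklore] flat loops ⇒ exact intertwining `Q₀ D_{V₀} = D_{V̄₀} Q′₀`. -/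
theorem Q0_covDZ_eq_covDZ_Qp0 (L : ℕ) (hL : 0 < L) (T : (Fin d → ℤ) → G) (R Rc : ZdEdge d → G)
    (lam : (Fin d → ℤ) → V) (y : Fin d → ℤ) (μ : Fin d)
    (h : ∀ x ∈ blockSites L y, loopHol L T R Rc (y, μ) x = 1) :
    Q0 L T R (covDZ R lam) (y, μ) = covDZ Rc (Qp0 L T lam) (y, μ) := by
  rw [Q0_covDZ_eq_covDZ_Qp0_add_defect L hL T R Rc, defect_eq_zero_of_loopHol_eq_one L T R Rc lam (y, μ) h,
    add_zero]

/-- [cite: Balaban1985Averaging, p.28] **"if λ satisfies the conditions Q′₀λ = 0, then the form of Q₀A is approximately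
preserved"**, made exact: for `λ ∈ N(Q′₀)`, `(Q₀A^λ)(c) = (Q₀A)(c) − defect(c)`. -/
theorem Q0_gauge_of_Qp0_eq_zero (L : ℕ) (hL : 0 < L) (T : (Fin d → ℤ) → G) (R Rc : ZdEdge d → G)
    (A : ZdEdge d → V) (lam : (Fin d → ℤ) → V) (hN : Qp0 L T lam = 0) (y : Fin d → ℤ) (μ : Fin d) :
    Q0 L T R (A - covDZ R lam) (y, μ) = Q0 L T R A (y, μ) - defect L T R Rc lam (y, μ) := by
  rw [Q0_sub, Q0_covDZ_eq_covDZ_Qp0_add_defect L hL T R Rc, hN, covDZ_zero, Pi.zero_apply, zero_add]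

/-- [folklore] … and EXACTLY preserved when moreover the loops are flat. -/
theorem Q0_gauge_of_Qp0_eq_zero_of_flat (L : ℕ) (hL : 0 < L) (T : (Fin d → ℤ) → G) (R Rc : ZdEdge d → G)
    (A : ZdEdge d → V) (lam : (Fin d → ℤ) → V) (hN : Qp0 L T lam = 0) (y : Fin d → ℤ) (μ : Fin d)
    (h : ∀ x ∈ blockSites L y, loopHol L T R Rc (y, μ) x = 1) :
    Q0 L T R (A - covDZ R lam) (y, μ) = Q0 L T R A (y, μ) := by
  rw [Q0_gauge_of_Qp0_eq_zero L hL T R Rc A lam hN,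
    defect_eq_zero_of_loopHol_eq_one L T R Rc lam (y, μ) h, sub_zero]

end Loop

/-! ## 4. "Approximately": the norm of the defect in the adjoint action -/

section Norm

variable {A : Type*} [NormedRing A]

/-- [folklore] the `ConjAct` action is conjugation `X ↦ U X U⁻¹` (B7 (56) `R(X)Y = XYX⁻¹`). -/
theorem conjAct_smul_eq (u : ConjAct Aˣ) (X : A) :
    u • X = ((ConjAct.ofConjAct u : Aˣ) : A) * X * (((ConjAct.ofConjAct u)⁻¹ : Aˣ) : A) :=
  ConjAct.units_smul_def u X

/-- [folklore] `‖H X H⁻¹ − X‖ ≤ 2‖H − 1‖‖X‖` in the `ConjAct` form (`B8CurlGradHolonomy.norm_conj_sub_le`). -/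
theorem norm_conjAct_smul_sub_le (u : ConjAct Aˣ) (X : A)
    (hu' : ‖(((ConjAct.ofConjAct u)⁻¹ : Aˣ) : A)‖ ≤ 1) :
    ‖u • X - X‖ ≤ 2 * ‖((ConjAct.ofConjAct u : Aˣ) : A) - 1‖ * ‖X‖ := by
  rw [conjAct_smul_eq]
  exact norm_conj_sub_le _ _ hu'

/-- [folklore] `‖W X W⁻¹‖ ≤ ‖X‖` in the `ConjAct` form (`B8CurlGradHolonomy.norm_conj_le`). -/
theorem norm_conjAct_smul_le (w : ConjAct Aˣ) (X : A) (hw : ‖((ConjAct.ofConjAct w : Aˣ) : A)‖ ≤ 1)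
    (hw' : ‖(((ConjAct.ofConjAct w)⁻¹ : Aˣ) : A)‖ ≤ 1) : ‖w • X‖ ≤ ‖X‖ := by
  rw [conjAct_smul_eq]
  exact norm_conj_le _ _ hw hw'

variable [NormedAlgebra ℝ A]

/-- [folklore] one term of the defect: `‖w • (H • W • z − W • z)‖ ≤ w · 2‖H − 1‖ · ‖z‖ ≤ w · 2εΛ` for `w ≥ 0`,
`‖H − 1‖ ≤ ε`, `‖H⁻¹‖ ≤ 1`, `‖W‖, ‖W⁻¹‖ ≤ 1`, `‖z‖ ≤ Λ`. -/
theorem norm_defect_term_le (w : ℝ) (hw : 0 ≤ w) (u v : ConjAct Aˣ) (z : A) (ε Λ : ℝ)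
    (hu : ‖((ConjAct.ofConjAct u : Aˣ) : A) - 1‖ ≤ ε) (hu' : ‖(((ConjAct.ofConjAct u)⁻¹ : Aˣ) : A)‖ ≤ 1)
    (hv : ‖((ConjAct.ofConjAct v : Aˣ) : A)‖ ≤ 1) (hv' : ‖(((ConjAct.ofConjAct v)⁻¹ : Aˣ) : A)‖ ≤ 1)
    (hz : ‖z‖ ≤ Λ) : ‖w • (u • v • z - v • z)‖ ≤ w * (2 * ε * Λ) := by
  rw [norm_smul, Real.norm_of_nonneg hw]
  refine mul_le_mul_of_nonneg_left ?_ hw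
  have h1 := norm_conjAct_smul_sub_le u (v • z) hu'
  have h2 : ‖v • z‖ ≤ Λ := (norm_conjAct_smul_le v z hv hv').trans hz
  have hε : 0 ≤ ε := (norm_nonneg _).trans hu
  exact h1.trans (mul_le_mul (mul_le_mul_of_nonneg_left hu zero_le_two) h2 (norm_nonneg _)
    (mul_nonneg zero_le_two hε))

/-- [folklore] **`‖defect(c)‖ ≤ 2 ε Λ`**: if on the block `B(c₋)` every loop holonomy satisfies
`‖V₀(Γ_{c,x}∪(−c)) − 1‖ ≤ ε` (with inverse of norm `≤ 1`), the transporters `R(V₀(c))·R(V₀(Γ_{c₊,x′}))` and their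
inverses have norm `≤ 1` (unitarity in the operator norm), and `‖λ(x′)‖ ≤ Λ` on `B(c₊)`, then the defect of the second
p. 28 term has norm at most `Σ_{x∈B(c₋)} L⁻ᵈ · 2ε · Λ = 2εΛ`. -/
theorem norm_defect_le (L : ℕ) (hL : 0 < L) (T : (Fin d → ℤ) → ConjAct Aˣ) (R Rc : ZdEdge d → ConjAct Aˣ)
    (lam : (Fin d → ℤ) → A) (c : ZdEdge d) (ε Λ : ℝ)
    (hhol : ∀ x ∈ blockSites L c.1, ‖((ConjAct.ofConjAct (loopHol L T R Rc c x) : Aˣ) : A) - 1‖ ≤ ε)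
    (hhol' : ∀ x ∈ blockSites L c.1, ‖(((ConjAct.ofConjAct (loopHol L T R Rc c x))⁻¹ : Aˣ) : A)‖ ≤ 1)
    (hW : ∀ x ∈ blockSites L c.1,
      ‖((ConjAct.ofConjAct (Rc c * T (x + Pi.single c.2 (L : ℤ))) : Aˣ) : A)‖ ≤ 1)
    (hW' : ∀ x ∈ blockSites L c.1,
      ‖(((ConjAct.ofConjAct (Rc c * T (x + Pi.single c.2 (L : ℤ))))⁻¹ : Aˣ) : A)‖ ≤ 1)
    (hlam : ∀ x ∈ blockSites L c.1, ‖lam (x + Pi.single c.2 (L : ℤ))‖ ≤ Λ) :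
    ‖defect L T R Rc lam c‖ ≤ 2 * ε * Λ := by
  have hLd : (0 : ℝ) < (L : ℝ) ^ d := by positivity
  have hw : (0 : ℝ) ≤ ((L : ℝ) ^ d)⁻¹ := (inv_pos.2 hLd).le
  unfold defect
  calc _ ≤ ∑ x ∈ blockSites L c.1, ((L : ℝ) ^ d)⁻¹ * (2 * ε * Λ) :=
        norm_sum_le_of_le _ fun x hx =>
          norm_defect_term_le _ hw _ _ _ ε Λ (hhol x hx) (hhol' x hx) (hW x hx) (hW' x hx) (hlam x hx)
    _ = 2 * ε * Λ := by
        rw [sum_const, card_blockSites, nsmul_eq_mul, Nat.cast_pow, ← mul_assoc, mul_inv_cancel₀ hLd.ne',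
          one_mul]

/-- [cite: Balaban1985Averaging, p.28] **"approximately preserved", quantified:** for `λ ∈ N(Q′₀)` and under the norm
hypotheses of `norm_defect_le`, `‖(Q₀A^λ)(c) − (Q₀A)(c)‖ ≤ 2εΛ`. -/
theorem norm_Q0_gauge_sub_le (L : ℕ) (hL : 0 < L) (T : (Fin d → ℤ) → ConjAct Aˣ) (R Rc : ZdEdge d → ConjAct Aˣ)
    (Afld : ZdEdge d → A) (lam : (Fin d → ℤ) → A) (hN : Qp0 L T lam = 0) (y : Fin d → ℤ) (μ : Fin d) (ε Λ : ℝ)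
    (hhol : ∀ x ∈ blockSites L y, ‖((ConjAct.ofConjAct (loopHol L T R Rc (y, μ) x) : Aˣ) : A) - 1‖ ≤ ε)
    (hhol' : ∀ x ∈ blockSites L y, ‖(((ConjAct.ofConjAct (loopHol L T R Rc (y, μ) x))⁻¹ : Aˣ) : A)‖ ≤ 1)
    (hW : ∀ x ∈ blockSites L y,
      ‖((ConjAct.ofConjAct (Rc (y, μ) * T (x + Pi.single μ (L : ℤ))) : Aˣ) : A)‖ ≤ 1)
    (hW' : ∀ x ∈ blockSites L y,
      ‖(((ConjAct.ofConjAct (Rc (y, μ) * T (x + Pi.single μ (L : ℤ))))⁻¹ : Aˣ) : A)‖ ≤ 1)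
    (hlam : ∀ x ∈ blockSites L y, ‖lam (x + Pi.single μ (L : ℤ))‖ ≤ Λ) :
    ‖Q0 L T R (Afld - covDZ R lam) (y, μ) - Q0 L T R Afld (y, μ)‖ ≤ 2 * ε * Λ := by
  rw [Q0_gauge_of_Qp0_eq_zero L hL T R Rc Afld lam hN, sub_sub_cancel_left, norm_neg]
  exact norm_defect_le L hL T R Rc lam (y, μ) ε Λ hhol hhol' hW hW' hlam

end Norm

/-! ## 5. The flat case `V₀ = 1` over `ℝ`, by name on `B7BlockGeometry.Qav` ([2] (1.11) = (125)) -/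

section Flat

/-- [cite: Balaban1985Averaging, p.28] `(∂λ)(b) = λ(b₊) − λ(b₋)`: `D_{V₀}λ` at `V₀ = 1` (B9 p. 393 `A^λ = A − Dλ`,
`η = 1`). -/
def dZ (lam : (Fin d → ℤ) → ℝ) : ZdEdge d → ℝ := fun b => lam (b.1 + Pi.single b.2 1) - lam b.1

/-- [folklore] unfolding of `dZ`. -/
@[simp] theorem dZ_apply (lam : (Fin d → ℤ) → ℝ) (b : ZdEdge d) :
    dZ lam b = lam (b.1 + Pi.single b.2 1) - lam b.1 := rfl

/-- [cite: Balaban1985Averaging, p.27] `(Q′λ)(y) = Σ_{x∈B(y)} L⁻ᵈλ(x)` (p. 27 bottom; B9 (3.19) with `R ≡ 1`), at block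
ratio `M` (ratio `M = Lʲ` gives the flat `Q′_j` of (3.19) by `Qp_Qp`). -/
def Qp (M : ℕ) : ((Fin d → ℤ) → ℝ) →ₗ[ℝ] ((Fin d → ℤ) → ℝ) where
  toFun lam y := ∑ x ∈ blockSites M y, ((M : ℝ) ^ d)⁻¹ * lam x
  map_add' f g := by
    ext y
    simp only [Pi.add_apply, mul_add, Finset.sum_add_distrib]
  map_smul' a f := by
    ext y
    simp only [Pi.smul_apply, smul_eq_mul, RingHom.id_apply, Finset.mul_sum]
    exact Finset.sum_congr rfl fun x _ => by ring

/-- [folklore] unfolding of `Qp`. -/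
@[simp] theorem Qp_apply (M : ℕ) (lam : (Fin d → ℤ) → ℝ) (y : Fin d → ℤ) :
    Qp M lam y = ∑ x ∈ blockSites M y, ((M : ℝ) ^ d)⁻¹ * lam x := rfl

/-- [folklore] `Q′` of a constant is the constant (`#B(y) = Mᵈ`). -/
theorem Qp_const (M : ℕ) (hM : 0 < M) (a : ℝ) (y : Fin d → ℤ) : Qp M (fun _ => a) y = a := by
  have hMd : ((M : ℝ) ^ d) ≠ 0 := by positivity
  rw [Qp_apply, sum_const, card_blockSites, nsmul_eq_mul, Nat.cast_pow, ← mul_assoc, mul_inv_cancel₀ hMd, one_mul]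

/-- [cite: Balaban1985BackgroundPropagators, (3.19) p.393] the composition rule of (3.19) in the flat case:
`Q′_K ∘ Q′_M = Q′_{MK}` (nested blocks, `B7BlockGeometry.sum_blockSites_mul`). -/
theorem Qp_Qp (M K : ℕ) (hM : 0 < M) (hK : 0 < K) (lam : (Fin d → ℤ) → ℝ) :
    Qp K (Qp M lam) = Qp (M * K) lam := by
  funext y
  simp only [Qp_apply]
  rw [sum_blockSites_mul M K hM hK]
  refine Finset.sum_congr rfl fun x' _ => ?_
  rw [Finset.mul_sum]
  refine Finset.sum_congr rfl fun z _ => ?_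
  rw [← mul_assoc, Nat.cast_mul, mul_pow, mul_inv, mul_comm (((K : ℝ) ^ d)⁻¹)]

/-- [folklore] **`Q_M(∂λ)(y, μ) = M⁻¹((Q′_Mλ)(y + e_μ) − (Q′_Mλ)(y))`** — the flat case of
`Q0_covDZ_eq_covDZ_Qp0`: the average (1.11) of a pure gauge field is the coarse gradient (spacing `M`) of the block
means (telescoping along each straight contour `[x, x + Me_μ]`, then `B(y) + Me_μ = B(y + e_μ)`). -/
theorem Qav_dZ (M : ℕ) (hM : 0 < M) (lam : (Fin d → ℤ) → ℝ) (y : Fin d → ℤ) (μ : Fin d) :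
    Qav M (dZ lam) (y, μ) = ((M : ℝ))⁻¹ * (Qp M lam (y + Pi.single μ 1) - Qp M lam y) := by
  have tele : ∀ x : Fin d → ℤ, ∑ l ∈ range M, ((M : ℝ) ^ (d + 1))⁻¹ * dZ lam (x + Pi.single μ (l : ℤ), μ)
      = ((M : ℝ) ^ (d + 1))⁻¹ * (lam (x + Pi.single μ (M : ℤ)) - lam x) := by
    intro x
    rw [← Finset.mul_sum]
    congr 1
    have key := Finset.sum_range_sub (fun l : ℕ => lam (x + Pi.single μ (l : ℤ))) M
    simp only [Nat.cast_zero, Pi.single_zero, add_zero] at key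
    rw [← key]
    refine Finset.sum_congr rfl fun l _ => ?_
    simp only [dZ_apply, add_assoc, ← Pi.single_add, Nat.cast_succ]
  rw [Qav_apply, Finset.sum_congr rfl fun x _ => tele x, ← Finset.mul_sum, Finset.sum_sub_distrib, Qp_apply,
    Qp_apply, sum_blockSites_add_single M hM y μ 1, mul_one, ← Finset.mul_sum, ← Finset.mul_sum]
  rw [pow_succ]
  ring

/-- [folklore] `Q_M(∂λ) = 0` on every coarse bond iff the block means `Q′_Mλ` agree across every coarse bond. -/
theorem Qav_dZ_eq_zero_iff (M : ℕ) (hM : 0 < M) (lam : (Fin d → ℤ) → ℝ) :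
    Qav M (dZ lam) = 0 ↔ ∀ (y : Fin d → ℤ) (μ : Fin d), Qp M lam (y + Pi.single μ 1) = Qp M lam y := by
  have hMne : ((M : ℝ))⁻¹ ≠ 0 := inv_ne_zero (by exact_mod_cast hM.ne')
  constructor
  · intro h y μ
    have hc := congr_fun h (y, μ)
    rw [Qav_dZ M hM, Pi.zero_apply, mul_eq_zero] at hc
    rcases hc with hc | hc
    · exact absurd hc hMne
    · exact sub_eq_zero.1 hc
  · intro h
    funext c
    obtain ⟨y, μ⟩ := c
    rw [Qav_dZ M hM, h y μ, sub_self, mul_zero, Pi.zero_apply]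

/-- [folklore] `λ ∈ N(Q′_M)` ⇒ `Q_M(∂λ) = 0`. -/
theorem Qav_dZ_of_Qp_eq_zero (M : ℕ) (hM : 0 < M) (lam : (Fin d → ℤ) → ℝ) (hN : Qp M lam = 0) :
    Qav M (dZ lam) = 0 :=
  (Qav_dZ_eq_zero_iff M hM lam).2 fun y μ => by rw [hN, Pi.zero_apply, Pi.zero_apply]

/-- [cite: Balaban1985Averaging, p.27] **p. 27: "we make a gauge transformation λ satisfying
(Q′λ)(y) = Σ_{x∈B(y)} L⁻ᵈλ(x) = 0. Such a transformation does not change the average given by (1.11) in [2]"** —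
kernel-checked for the tree's `Qav` (= (1.11)): `Q′_Mλ = 0 ⇒ Q_M(A − ∂λ) = Q_M A`. -/
theorem Qav_gauge_of_Qp_eq_zero (M : ℕ) (hM : 0 < M) (lam : (Fin d → ℤ) → ℝ) (hN : Qp M lam = 0)
    (Afld : ZdEdge d → ℝ) : Qav M (Afld - dZ lam) = Qav M Afld := by
  rw [map_sub, Qav_dZ_of_Qp_eq_zero M hM lam hN, sub_zero]

/-- [folklore] The flat, all-of-`ℤᵈ` reading of `λ ∈ N(Q′)` (B9 (3.21): all the `Q′_j`, `j = 0, …, k`) against the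
family of averaging constraints B8 (1.36) `Q_j(U₀, ηA) = B, j ≤ k` at `U₀ = 1`: if `Q′_{Lʲ}λ = 0` for all `j ≤ k`, then
`Q_{Lʲ}(A − ∂λ) = Q_{Lʲ}A` for all `j ≤ k` — a pure-gauge increment with `λ ∈ N(Q′)` is invisible to every averaging
constraint (these directions are the business of the gauge-fixing density B9 (3.17) `∫dλ δ(Q′λ) …` and of (1.38), not of
the averaging constraints). -/
theorem Qav_pow_gauge_of_null (L k : ℕ) (hL : 0 < L) (lam : (Fin d → ℤ) → ℝ)
    (hN : ∀ j ≤ k, Qp (L ^ j) lam = 0) (Afld : ZdEdge d → ℝ) :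
    ∀ j ≤ k, Qav (L ^ j) (Afld - dZ lam) = Qav (L ^ j) Afld :=
  fun j hj => Qav_gauge_of_Qp_eq_zero (L ^ j) (pow_pos hL j) lam (hN j hj) Afld

/-! ### Dictionary: § 2–§ 3 with trivial transporters are the flat objects -/

variable {G : Type*} [Monoid G]

/-- [folklore] `lineR` of trivial transporters is `1`. -/
@[simp] theorem lineR_const_one (x : Fin d → ℤ) (μ : Fin d) (l : ℕ) :
    lineR (fun _ : ZdEdge d => (1 : G)) x μ l = 1 :=
  pathProd_const_one l

variable [DistribMulAction G ℝ]

/-- [folklore] `D_{V₀}` at `V₀ = 1` is `∂`. -/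
theorem covDZ_const_one (lam : (Fin d → ℤ) → ℝ) : covDZ (fun _ : ZdEdge d => (1 : G)) lam = dZ lam := by
  funext b
  rw [covDZ_apply, one_smul, dZ_apply]

/-- [folklore] `Q′₀` with trivial transporters is the flat `Q′` at ratio `L`. -/
theorem Qp0_const_one (L : ℕ) (lam : (Fin d → ℤ) → ℝ) :
    Qp0 L (fun _ : Fin d → ℤ => (1 : G)) lam = Qp L lam := by
  funext y
  simp only [Qp0_apply, Qp_apply, one_smul, smul_eq_mul]

/-- [folklore] **p. 28's `Q₀` (weight `L⁻ᵈ`) with trivial transporters is `L · Q` for the tree's `Q = Qav L`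
(weight `L⁻⁽ᵈ⁺¹⁾`, [2] (1.11) = (125))** — the factor `Lʲη` of B9 (3.14) at `j = 1`, `η = 1`. -/
theorem Q0_const_one (L : ℕ) (hL : 0 < L) (Afld : ZdEdge d → ℝ) (c : ZdEdge d) :
    Q0 L (fun _ : Fin d → ℤ => (1 : G)) (fun _ : ZdEdge d => (1 : G)) Afld c = (L : ℝ) * Qav L Afld c := by
  obtain ⟨y, μ⟩ := c
  have hLr : (L : ℝ) ≠ 0 := by exact_mod_cast hL.ne'
  simp only [Q0_apply, lineRA, lineR_const_one, mul_one, one_smul, smul_eq_mul, Qav_apply, Finset.mul_sum]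
  refine Finset.sum_congr rfl fun x _ => Finset.sum_congr rfl fun l _ => ?_
  rw [pow_succ, mul_inv, ← mul_assoc, ← mul_assoc, mul_comm (L : ℝ), mul_assoc (((L : ℝ) ^ d)⁻¹),
    mul_inv_cancel₀ hLr, mul_one]

end Flat

section FlatLoop

variable {G : Type*} [Group G]

/-- [folklore] with trivial transporters every loop is flat … -/
@[simp] theorem loopHol_const_one (L : ℕ) (c : ZdEdge d) (x : Fin d → ℤ) :
    loopHol L (fun _ : Fin d → ℤ => (1 : G)) (fun _ : ZdEdge d => (1 : G)) (fun _ : ZdEdge d => (1 : G)) c x = 1 := by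
  simp [loopHol, lineR]

variable [DistribMulAction G ℝ]

/-- [folklore] … so the defect vanishes identically: the flat § 5 is the defect-free case of § 3. -/
theorem defect_const_one (L : ℕ) (lam : (Fin d → ℤ) → ℝ) (c : ZdEdge d) :
    defect L (fun _ : Fin d → ℤ => (1 : G)) (fun _ : ZdEdge d => (1 : G)) (fun _ : ZdEdge d => (1 : G)) lam c = 0 :=
  defect_eq_zero_of_loopHol_eq_one _ _ _ _ _ _ fun x _ => loopHol_const_one L c x

end FlatLoop

end Literature.MathematicalPhysics.QuantumFieldTheory.Balaban1983to89.B7Eq61Linearization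

end
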